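import Summits.ResolutionOfSingularities.ResolutionOfSingularities.Theorems.FrobeniusClosingSteerTwoBasisSubstitution
import Summits.ResolutionOfSingularities.ResolutionOfSingularities.Theorems.FrobeniusClosingSteerChartMonomialSubst
import Literature.RingTheory.MvPowerSeries.MaximalIdealPow
import HarnessLib

/-!
# Crux `Steer` (stmt-ResolutionOfSingularities-16345), chain W4.1, hGW3 piece (S_λ): algebra of the λ-COMPONENTS `sqPart F ε` of a power series
# over a field with a finite 2-basis — transport of the basis, scaling by even powers of a letter, adding a square, monomial chart substitutions,
# the 2-basis zero test on coefficients, and the transport of a degree bound through `θ_j S = X_j^n · R`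

OURS (campaign `res-hironaka`, rung L ★L-G4, slot W4.1; seat res-L0-w41-stub-3 g8, res-L0-w41-plan-1 RULING 251 (c) «(S_λ) → stub-3»; spec = res-L0-w41-stub-2's
`hGW3-ASSEMBLY-MAP.md` d0970ee959ebaf4a §2 (S_λ) «ONLY (N) changes: the λ-version reads the odd-support condition on EVERY λ-component»; vocabulary =
res-D-lib-1's K-GG1 `TwoBasis.IsTwoBasis` / `sqPart` / `oddPart` (`…TwoBasisDecompositionA` p549638, (D3) `…TwoBasisSubstitution`) and res-D-pv-007's chart
substitutions `substGenerators` at a letter (`…ChartMonomialSubst` p536416); replaces the role of no printed item; NOT a statement of the manuscript under review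
[claim: Hironaka2017, status: under-review]; AI-produced, weaker than expert review). Theses-free, definition-free.

* `IsTwoBasis.map_ringEquiv` — a 2-basis is carried to a 2-basis by a ring isomorphism (used for `κ(S₁) ≃ κ(Ŝ₁)`);
* `coeff_two_nsmul_ne_zero_of_coeff_sqPart_ne_zero` — the 2-basis ZERO TEST on coefficients: a monomial `α` of some `sqPart F ε` is a monomial `2α` of `F`;
* `le_degree_of_coeff_sqPart_ne_zero` — hence `F ∈ 𝔪^(2n)` bounds the monomials of every `sqPart F ε` below by degree `n`;
* `sqPart_X_pow_mul` — `sqPart (X_j^(2n)·F) ε = X_j^n · sqPart F ε` (and `oddPart (X_j^(2n)·F) = X_j^(2n)·oddPart F`);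
* `sqPart_sq_add_of_ne_zero` — adding a square only moves the `ε = 0` component: `sqPart (A² + W) ε = sqPart W ε` for `ε ≠ 0`;
* `sqPart_substGenerators_chart` — the chart substitution at a letter commutes with `sqPart` / `oddPart` ((D3) + parity reflection `dvd_of_dvd_expSum_chart`);
* `map_substGenerators_chart` — a change of coefficients commutes with the chart substitution;
* `two_mul_le_degree_expSum_of_eq_X_pow_mul` — if `θ_j S = X_j^n · R` and every monomial of `R` has degree `≥ n`, every monomial `γ` of `S` has `|θ_j γ| ≥ 2n`.
[folklore]
-/

noncomputable section

set_option linter.dupNamespace false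

open MvPowerSeries
open Literature.RingTheory.MvPowerSeries Literature.RingTheory.MvPowerSeries.monoidPowerSeries
open Summit.ResolutionOfSingularities.ResolutionOfSingularities.Theorems.SwitchingDichotomy.ChartMonomialSubst
open Summit.ResolutionOfSingularities.ResolutionOfSingularities.Theorems.SwitchingDichotomy.TwoBasis

namespace Summit.ResolutionOfSingularities.ResolutionOfSingularities.Theorems.SwitchingDichotomy.NoSatelliteStepTwoBasis

/-! ## Transport of a 2-basis along a ring isomorphism -/

/-- **A ring isomorphism carries a finite 2-basis to a finite 2-basis.** [folklore] -/
theorem IsTwoBasis.map_ringEquiv {F F' : Type} [Field F] [Field F'] (e : F ≃+* F') {r : ℕ} {b : Fin r → F} (hb : IsTwoBasis b) :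
    IsTwoBasis (fun i => e (b i)) := by
  have hlam : ∀ ε, lamPow (fun i => e (b i)) ε = e (lamPow b ε) := fun ε => by
    unfold lamPow; rw [map_prod]; simp_rw [map_pow]
  intro a
  obtain ⟨β, hβ, huniq⟩ := hb (e.symm a)
  refine ⟨fun ε => e (β ε), ?_, fun β' hβ' => ?_⟩
  · have h := congrArg e hβ
    rw [RingEquiv.apply_symm_apply, map_sum] at h
    rw [h]
    exact Finset.sum_congr rfl fun ε _ => by rw [map_mul, map_pow, hlam]
  · have h : e.symm a = ∑ ε, lamPow b ε * (e.symm (β' ε)) ^ 2 := by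
      rw [hβ', map_sum]
      exact Finset.sum_congr rfl fun ε _ => by rw [map_mul, map_pow, hlam, RingEquiv.symm_apply_apply]
    have hb' := huniq _ h
    funext ε
    have := congrFun hb' ε
    rw [← this, RingEquiv.apply_symm_apply]

variable {K : Type} [Field K] [CharP K 2] {c r : ℕ} (b : Fin r → K) (hB : IsTwoBasis b)

/-! ## The 2-basis zero test on coefficients -/

/-- **Zero test.** If `coeff α (sqPart F ε) ≠ 0` for some `ε` then `coeff (2α) F ≠ 0` (`coeff (2α) F = ∑ ε, λ^ε (coeff α (sqPart F ε))²` and the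
`λ^ε` are `K²`-independent). [folklore] -/
theorem coeff_two_nsmul_ne_zero_of_coeff_sqPart_ne_zero (F : MvPowerSeries (Fin c) K) {ε : Fin r → Fin 2} {α : Fin c →₀ ℕ}
    (h : MvPowerSeries.coeff α (sqPart b hB F ε) ≠ 0) : MvPowerSeries.coeff (2 • α) F ≠ 0 := by
  intro h0
  rw [coeff_two_nsmul_eq_sum_sqPart b hB F α, hB.sum_eq_zero_iff] at h0
  exact h (by rw [show MvPowerSeries.coeff α (sqPart b hB F ε) = (fun ε => MvPowerSeries.coeff α (sqPart b hB F ε)) ε from rfl, h0]; rfl)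

/-- **Degree bound on the components of a member of `𝔪^(2n)`**: every monomial of every `sqPart F ε` has degree `≥ n`. [folklore] -/
theorem le_degree_of_coeff_sqPart_ne_zero {n : ℕ} {F : MvPowerSeries (Fin c) K}
    (hF : F ∈ IsLocalRing.maximalIdeal (MvPowerSeries (Fin c) K) ^ (2 * n)) {ε : Fin r → Fin 2} {α : Fin c →₀ ℕ}
    (h : MvPowerSeries.coeff α (sqPart b hB F ε) ≠ 0) : n ≤ α.degree := by
  have h2 := coeff_two_nsmul_ne_zero_of_coeff_sqPart_ne_zero b hB F h
  by_contra hlt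
  rw [not_le] at hlt
  refine h2 (Jets.coeff_eq_zero_of_mem_maximalIdeal_pow hF ?_)
  rw [map_nsmul, smul_eq_mul]
  omega

/-! ## Scaling by an even power of a letter -/

omit [CharP K 2] in
/-- A monomial all of whose exponents are even, minus `2n` at one letter (when possible), still has even exponents. [folklore] -/
theorem forall_even_tsub_single {α : Fin c →₀ ℕ} (hα : ∀ i, Even (α i)) (j : Fin c) (n : ℕ) :
    ∀ i, Even ((α - Finsupp.single j (2 * n)) i) := by
  intro i
  rw [Finsupp.tsub_apply]
  by_cases hij : i = j
  · subst hij
    rw [Finsupp.single_eq_same]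
    obtain ⟨k, hk⟩ := hα i
    exact ⟨k - n, by omega⟩
  · rw [Finsupp.single_eq_of_ne hij, tsub_zero]
    exact hα i

/-- **`sqPart (X_j^(2n) · F) ε = X_j^n · sqPart F ε`** and `oddPart (X_j^(2n) · F) = X_j^(2n) · oddPart F` (uniqueness of the λ-decomposition: the
shifted odd part is still supported off the even exponents). [folklore] -/
theorem sqPart_X_pow_mul (F : MvPowerSeries (Fin c) K) (j : Fin c) (n : ℕ) :
    (∀ ε, sqPart b hB (X j ^ (2 * n) * F) ε = X j ^ n * sqPart b hB F ε) ∧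
      oddPart b hB (X j ^ (2 * n) * F) = X j ^ (2 * n) * oddPart b hB F := by
  have h := sqPart_oddPart_unique b hB (X j ^ (2 * n) * F) (fun ε => X j ^ n * sqPart b hB F ε) (X j ^ (2 * n) * oddPart b hB F)
    (by
      conv_lhs => rw [eq_sum_sqPart_add_oddPart b hB F]
      rw [mul_add, Finset.mul_sum]
      refine congrArg (· + _) (Finset.sum_congr rfl fun ε _ => ?_)
      rw [mul_pow, ← pow_mul, mul_comm n 2]; ring)
    (fun α hα => by
      rw [X_pow_eq, coeff_monomial_mul]
      split_ifs with hle
      · rw [one_mul]; exact coeff_oddPart_of_even b hB F (forall_even_tsub_single hα j n)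
      · rfl)
  exact ⟨fun ε => congrFun h.1 ε, h.2⟩

/-! ## Adding a square -/

/-- **Adding a square only moves the `ε = 0` component**: `sqPart (A² + W) ε = sqPart W ε` for `ε ≠ 0` (characteristic `2`: `A² + W = W − A²`, then
`sqPart_sub_sq`). [folklore] -/
theorem sqPart_sq_add_of_ne_zero (A W : MvPowerSeries (Fin c) K) {ε : Fin r → Fin 2} (hε : ε ≠ 0) :
    sqPart b hB (A ^ 2 + W) ε = sqPart b hB W ε := by
  haveI : CharP (MvPowerSeries (Fin c) K) 2 := charP_of_injective_algebraMap (MvPowerSeries.C_injective (σ := Fin c) (R := K)) 2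
  have hAW : A ^ 2 + W = W - A ^ 2 := by rw [CharTwo.sub_eq_add, add_comm]
  rw [hAW, (sqPart_sub_sq b hB W A).1, Function.update_of_ne hε]

/-! ## Chart substitutions commute with the λ-decomposition -/

section Chart

variable (j : Fin c) (M : ℕ)

omit [CharP K 2] in
/-- `expSum` of the chart family as a `Fintype` sum (the shape used by (D3) `lambdaDecomp_subst_monomial`). [folklore] -/
theorem expSum_chart_eq_sum (α : Fin c →₀ ℕ) :
    expSum (fun i : Fin c => Finsupp.single i 1 + if i = j then 0 else M • Finsupp.single j 1) α =
      ∑ i, α i • (Finsupp.single i 1 + if i = j then 0 else M • Finsupp.single j 1 : Fin c →₀ ℕ) := by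
  unfold expSum
  exact Finsupp.sum_fintype _ _ fun i => zero_smul _ _

omit [CharP K 2] in
/-- **Parity reflection of the chart** in the shape of (D3): an exponent with an odd entry substitutes to one. [folklore] -/
theorem chart_odd_of_odd (α : Fin c →₀ ℕ) (hα : ∃ i, Odd (α i)) :
    ∃ j', Odd ((∑ i, α i • (Finsupp.single i 1 + if i = j then 0 else M • Finsupp.single j 1 : Fin c →₀ ℕ)) j') := by
  by_contra h
  push Not at h
  obtain ⟨i, hi⟩ := hα
  have h2 : ∀ s, 2 ∣ expSum (fun i : Fin c => Finsupp.single i 1 + if i = j then 0 else M • Finsupp.single j 1) α s := fun s => by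
    rw [expSum_chart_eq_sum]
    exact even_iff_two_dvd.mp (Nat.not_odd_iff_even.mp (h s))
  exact (Nat.not_even_iff_odd.mpr hi) (even_iff_two_dvd.mpr (dvd_of_dvd_expSum_chart j M 2 α h2 i))

/-- **The chart substitution at a letter commutes with `sqPart` and `oddPart`** (K-GG1 (D3) `lambdaDecomp_subst_monomial` at the chart family, whose exponent
map reflects parity). [folklore] -/
theorem sqPart_substGenerators_chart (F : MvPowerSeries (Fin c) K) :
    (∀ ε, sqPart b hB (substGenerators (R := K) (fun i : Fin c => Finsupp.single i 1 + if i = j then 0 else M • Finsupp.single j 1)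
        (chartExp_ne_zero j M) F) ε =
      substGenerators (R := K) (fun i : Fin c => Finsupp.single i 1 + if i = j then 0 else M • Finsupp.single j 1)
        (chartExp_ne_zero j M) (sqPart b hB F ε)) ∧
    oddPart b hB (substGenerators (R := K) (fun i : Fin c => Finsupp.single i 1 + if i = j then 0 else M • Finsupp.single j 1)
        (chartExp_ne_zero j M) F) =
      substGenerators (R := K) (fun i : Fin c => Finsupp.single i 1 + if i = j then 0 else M • Finsupp.single j 1)
        (chartExp_ne_zero j M) (oddPart b hB F) := by
  simp only [substGenerators_apply]
  have h := lambdaDecomp_subst_monomial b hB (fun i : Fin c => Finsupp.single i 1 + if i = j then 0 else M • Finsupp.single j 1)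
    (chartExp_ne_zero j M) (chart_odd_of_odd j M) F
  exact ⟨h.2, h.1⟩

omit [CharP K 2] in
/-- **A change of coefficients commutes with the chart substitution** (exact coefficient transport along the injective exponent map). [folklore] -/
theorem map_substGenerators_chart {K' : Type} [CommRing K'] (f : K →+* K') (F : MvPowerSeries (Fin c) K) :
    MvPowerSeries.map f (substGenerators (R := K) (fun i : Fin c => Finsupp.single i 1 + if i = j then 0 else M • Finsupp.single j 1)
        (chartExp_ne_zero j M) F) =
      substGenerators (R := K') (fun i : Fin c => Finsupp.single i 1 + if i = j then 0 else M • Finsupp.single j 1)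
        (chartExp_ne_zero j M) (MvPowerSeries.map f F) := by
  ext e
  by_cases he : ∃ d, expSum (fun i : Fin c => Finsupp.single i 1 + if i = j then 0 else M • Finsupp.single j 1) d = e
  · obtain ⟨d, rfl⟩ := he
    rw [coeff_map, coeff_substGenerators_chart_expSum, coeff_substGenerators_chart_expSum, coeff_map]
  · push Not at he
    rw [coeff_map, coeff_substGenerators_eq_zero_of_forall_ne _ _ _ he, coeff_substGenerators_eq_zero_of_forall_ne _ _ _ he, map_zero]

omit [CharP K 2] in
/-- **Degree transport through `θ_j S = X_j^n · R`.** If every monomial of `R` has degree `≥ n`, then every monomial `γ` of `S` has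
`2n ≤ |expSum γ|` for the chart at the letter `j` (weight `M`). [folklore] -/
theorem two_mul_le_degree_expSum_of_eq_X_pow_mul {n : ℕ} {S R : MvPowerSeries (Fin c) K}
    (h : substGenerators (R := K) (fun i : Fin c => Finsupp.single i 1 + if i = j then 0 else M • Finsupp.single j 1)
      (chartExp_ne_zero j M) S = X j ^ n * R)
    (hR : ∀ α : Fin c →₀ ℕ, MvPowerSeries.coeff α R ≠ 0 → n ≤ α.degree)
    {γ : Fin c →₀ ℕ} (hγ : MvPowerSeries.coeff γ S ≠ 0) :
    2 * n ≤ (expSum (fun i : Fin c => Finsupp.single i 1 + if i = j then 0 else M • Finsupp.single j 1) γ).degree := by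
  have hc := coeff_substGenerators_chart_expSum j M S γ
  rw [h, X_pow_eq, coeff_monomial_mul] at hc
  split_ifs at hc with hle
  · rw [one_mul] at hc
    have hn := hR _ (by rw [hc]; exact hγ)
    have hdeg : (expSum (fun i : Fin c => Finsupp.single i 1 + if i = j then 0 else M • Finsupp.single j 1) γ).degree =
        (expSum (fun i : Fin c => Finsupp.single i 1 + if i = j then 0 else M • Finsupp.single j 1) γ - Finsupp.single j n).degree + n := by
      conv_lhs => rw [← tsub_add_cancel_of_le hle]
      rw [map_add, Finsupp.degree_single]
    omega
  · exact absurd hc.symm hγ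

end Chart

end Summit.ResolutionOfSingularities.ResolutionOfSingularities.Theorems.SwitchingDichotomy.NoSatelliteStepTwoBasis

end
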